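import Literature.Analysis.InnerProduct.HilbertComplexEigenvalueComparison
import Literature.Analysis.InnerProduct.HilbertComplexIsomorphismInvariance
import Literature.Analysis.InnerProduct.HilbertComplexHeatTrace
import HarnessLib

/-!
# Eigenvalue comparison for the middle Laplacian `□ = TT* + S*S` of isomorphic discrete short complexes
# (Brüning–Lesch 1992, Lemma 2.17 (2.52), middle degree): `N_□(λ) ≤ N_□′(Cλ)` through the supersymmetric count
# `N_□(λ) = #{μ_□ = 0} + n_{T*T}(λ) + n_{SS*}(λ)` and the isomorphism invariance of the three kernel multiplicities

Layer `Literature/Analysis/InnerProduct`, namespace `Literature.Analysis.InnerProduct`; sequel BY NAME of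
`HilbertComplexEigenvalueComparison.lean` (row g34-#7: `adjoint_map_of_map`, `ncard_eigenvalue_adjointCompSelf_lt_le_of_map`,
`ncard_eigenvalue_selfCompAdjoint_lt_le_of_map` — (2.52) for the outer Laplacians), `HilbertComplexIsomorphismInvariance.lean`
(row g34-#6: `finrank_pmapKer_eq_of_iso`, `finrank_harmonic_eq_of_iso`, `nonempty_pmapKer_linearEquiv_of_iso`),
`HilbertComplexEigenspaceSupersymmetry.lean` (row g33-#1: `ncard_eigenvalue_eq_add_of_short_complex`, the cancellation of
non-zero multiplicities `#{μ_F = m} = #{μ_E = m} + #{μ_G = m}`), `HilbertComplexHeatTrace.lean` /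
`HilbertComplexHeatFlow.lean` (`ncard_eigenvalue_zero_eq_finrank_pmapKer`, `ncard_eigenvalue_zero_eq_finrank_pmapKer_adjoint`,
`finrank_harmonic_eq_ncard`: `#{μ = 0} = dim Ker T, dim 𝔥, dim Ker S*`) and `HilbertComplexLaplacianDiagonal.lean`
(`eigenvalue_nonneg`, `finite_setOf_eigenvalue_le/eq`). Lane `lit-hodgefound` (Track 2 foundations library), prover seat
`lit-hodgefound-p06` (generation 34), self-proposed row g34-#8. THEOREMS ONLY (no definition, no instance, no named
fact). Setting: a short complex `0 → E →T F →S G → 0` (`Im T ⊆ Ker S`) whose three Laplacians `T*T` (`hdomA`/`hvalA`),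
`□ = TT* + S*S` (`hdom`/`hval`), `SS*` (`hdomC`/`hvalC`) have Hilbert bases of eigenvectors `b_E, b_F, b_G` with
eigenvalues `μ_E, μ_F, μ_G → ∞` ("discrete"), a second such complex (primed), and an isomorphism of complexes
`(g_E, g_F, g_G) ⇄ (k_E, k_F, k_G)` in the sense of `HilbertComplexMaps.lean` with norm bounds `M_g`, `M_k`.

## Source, verbatim

J. Brüning, M. Lesch, *Hilbert complexes*, J. Funct. Anal. 108 (1992), §2 Lemma 2.17 p. 104 (held text
`paper:doi-10-1016-0022-1236-92-90147-b`, p0017): "LEMMA 2.17. Discreteness is invariant under complex isomorphisms. More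
precisely, if `(𝒟, D)` is a discrete Hilbert complex and `g : (𝒟, D) → (𝒟′, D′)` is a complex isomorphism then we have
for the eigenvalues `λₙ`, `λ′ₙ` of `Δ` and `Δ′`: `C⁻¹λₙ ≤ λ′ₙ ≤ Cλₙ`, `n ≥ 1` (2.52), with some constant `C` independent of
`n`." The printed proof (p. 103, (2.50)–(2.51)) compares the forms through the map `k = h¹ ⊕ g² ⊕ ĝ` on the weak Hodge
decomposition `cl Im D_{i−1} ⊕ cl Im D*_i ⊕ 𝓗̂_i`; here the middle degree is reduced to the outer degrees instead, by
P. B. Gilkey, *Invariance theory …* (1995), §1.6 Lemma 1.6.5 ("`∑ (−1)ⁱ dim E_i(λ) = 0` for `λ ≠ 0`") = row g33-#1, which is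
exactly the statement that `k` is built from `g` on the coexact part and `h = (g⁻¹)*` on the exact part.

## What is proved (all over `𝕜 = ℝ` or `ℂ`)

* §1 **`ncard_eigenvalue_pos_lt_eq_add_of_short_complex`**: `#{0 < μ_F < λ} = #{0 < μ_E < λ} + #{0 < μ_G < λ}` (the
  non-zero spectrum of `□` below `λ`, with multiplicity, is that of `T*T` plus that of `SS*`), and
  **`ncard_eigenvalue_lt_add_eq_of_short_complex`**: `N_□(λ) + z_E + z_G = z_F + N_{T*T}(λ) + N_{SS*}(λ)` for `λ > 0`
  (`N_X(λ) = #{μ_X < λ}`, `z_X = #{μ_X = 0}`).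
* §2 the kernel multiplicities are isomorphism invariants: **`ncard_eigenvalue_zero_adjointCompSelf_eq_of_iso`**
  (`z_E = dim Ker T`), **`ncard_eigenvalue_zero_laplacian_eq_of_iso`** (`z_F = dim 𝔥`),
  **`ncard_eigenvalue_zero_selfCompAdjoint_eq_of_iso`** (`z_G = dim Ker S*`, through the adjoint isomorphism
  `Ker S* ≅ Ker S′*` of row g34-#7 §1).
* §3 **`ncard_eigenvalue_laplacian_lt_le_of_iso`**: `#{μ_F < λ} ≤ #{μ′_F < (M_g M_k)²λ}` for every `λ`, and the two-sided
  **`ncard_eigenvalue_laplacian_comparison_of_iso`** — Lemma 2.17 (2.52) for the middle Laplacian, so that together with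
  row g34-#7 all three Laplacians of the short complex are covered. As in row g34-#7 both complexes are ASSUMED discrete
  (the existence half of "discreteness is invariant" is not formalized).

## References

* [BruningLesch1992] J. Brüning, M. Lesch, *Hilbert complexes*, J. Funct. Anal. 108 (1992) 88–132, §2 Lemma 2.17 (2.52),
  Cor 2.19.
* [Gilkey1995] P. B. Gilkey, *Invariance Theory, the Heat Equation, and the Atiyah–Singer Index Theorem*, 2nd ed. (1995),
  §1.6 Lemma 1.6.5.
* [McKeanSinger1967] H. P. McKean, I. M. Singer, J. Differential Geom. 1 (1967), §6 (3b).
* [Schmudgen2012] K. Schmüdgen, *Unbounded Self-adjoint Operators on Hilbert Space*, §12.1 Thm 12.1 (max–min).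
-/

noncomputable section

open scoped InnerProductSpace LinearPMap
open Filter Topology

namespace Literature.Analysis.InnerProduct

variable {𝕜 E F G E' F' G' : Type*} [RCLike 𝕜]
variable [NormedAddCommGroup E] [InnerProductSpace 𝕜 E]
variable [NormedAddCommGroup F] [InnerProductSpace 𝕜 F]
variable [NormedAddCommGroup G] [InnerProductSpace 𝕜 G]
variable [NormedAddCommGroup E'] [InnerProductSpace 𝕜 E']
variable [NormedAddCommGroup F'] [InnerProductSpace 𝕜 F']
variable [NormedAddCommGroup G'] [InnerProductSpace 𝕜 G']

/-! ### §0 Plumbing: the zero end, adjoints of inverse pairs, counting below a level -/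

/-- The zero operator is everywhere, hence densely, defined. [folklore] -/
private theorem dense_zero_pmap_domain {D : Type*} [NormedAddCommGroup D] [InnerProductSpace 𝕜 D] :
    Dense (((0 : D →ₗ.[𝕜] E).domain : Submodule 𝕜 D) : Set D) := by
  rw [LinearPMap.zero_domain, Submodule.top_coe]; exact dense_univ

/-- `k ∘ g = id ⇒ g* ∘ k* = id` (pointwise). [folklore] -/
private theorem adjoint_apply_adjoint_apply_of_leftInverse [CompleteSpace E] [CompleteSpace F] {g : E →L[𝕜] F}
    {k : F →L[𝕜] E} (hkg : ∀ x : E, k (g x) = x) (z : E) :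
    ContinuousLinearMap.adjoint g (ContinuousLinearMap.adjoint k z) = z := by
  refine ext_inner_right 𝕜 fun x ↦ ?_
  rw [ContinuousLinearMap.adjoint_inner_left, ContinuousLinearMap.adjoint_inner_left, hkg]

omit [RCLike 𝕜] in
/-- For a non-negative family, `#{μ < λ} = #{μ = 0} + #{0 < μ < λ}` (`λ > 0`). [folklore] -/
private theorem ncard_lt_eq_ncard_zero_add {ι : Type*} {μ : ι → ℝ} {l : ℝ} (hμ : ∀ i, 0 ≤ μ i)
    (hfin : {i | μ i < l}.Finite) (hl : 0 < l) :
    {i | μ i < l}.ncard = {i | μ i = 0}.ncard + {i | 0 < μ i ∧ μ i < l}.ncard := by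
  have hunion : {i | μ i < l} = {i | μ i = 0} ∪ {i | 0 < μ i ∧ μ i < l} := by
    ext i
    simp only [Set.mem_setOf_eq, Set.mem_union]
    refine ⟨fun h ↦ ?_, fun h ↦ ?_⟩
    · rcases (hμ i).eq_or_lt with h0 | h0
      · exact Or.inl h0.symm
      · exact Or.inr ⟨h0, h⟩
    · rcases h with h | h
      · rw [h]; exact hl
      · exact h.2
  have hdisj : Disjoint {i | μ i = 0} {i | 0 < μ i ∧ μ i < l} :=
    Set.disjoint_left.2 fun i h0 h ↦ h.1.ne' h0
  have hf1 : {i | μ i = 0}.Finite := hfin.subset fun i hi ↦ show μ i < l by rw [show μ i = 0 from hi]; exact hl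
  have hf2 : {i | 0 < μ i ∧ μ i < l}.Finite := hfin.subset fun i hi ↦ show μ i < l from hi.2
  rw [hunion, Set.ncard_union_eq hdisj hf1 hf2]

omit [RCLike 𝕜] in
/-- Counting by value: `#{0 < μ < λ} = ∑_{m ∈ M} #{μ = m}` for any finite set `M ⊆ (0, λ)` of reals containing the values
`μᵢ ∈ (0, λ)`. [folklore] -/
private theorem ncard_pos_lt_eq_sum {ι : Type*} {μ : ι → ℝ} {l : ℝ} (hs : {i | 0 < μ i ∧ μ i < l}.Finite)
    (M : Finset ℝ) (hM : ∀ i, 0 < μ i → μ i < l → μ i ∈ M) (hM' : ∀ m ∈ M, 0 < m ∧ m < l) :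
    {i | 0 < μ i ∧ μ i < l}.ncard = ∑ m ∈ M, {i | μ i = m}.ncard := by
  classical
  rw [Set.ncard_eq_toFinset_card _ hs, Finset.card_eq_sum_card_fiberwise (f := μ) (t := M) fun i hi ↦ by
    simp only [Finset.mem_coe, Set.Finite.mem_toFinset, Set.mem_setOf_eq] at hi ⊢; exact hM i hi.1 hi.2]
  refine Finset.sum_congr rfl fun m hm ↦ ?_
  have hfm : {i | μ i = m}.Finite :=
    hs.subset fun i (hi : μ i = m) ↦ show 0 < μ i ∧ μ i < l by rw [hi]; exact hM' m hm
  rw [Set.ncard_eq_toFinset_card _ hfm]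
  congr 1
  ext i
  simp only [Finset.mem_filter, Set.Finite.mem_toFinset, Set.mem_setOf_eq]
  exact ⟨fun h ↦ h.2, fun h ↦ ⟨by rw [h]; exact hM' m hm, h⟩⟩

/-! ### §1 One discrete short complex: `#{0 < μ_F < λ} = #{0 < μ_E < λ} + #{0 < μ_G < λ}` and
`N_□(λ) + z_E + z_G = z_F + N_{T*T}(λ) + N_{SS*}(λ)` -/

section OneComplex

variable [CompleteSpace E] [CompleteSpace F] [CompleteSpace G]
variable {T : E →ₗ.[𝕜] F} {S : F →ₗ.[𝕜] G} {A : E →ₗ.[𝕜] E} {L : F →ₗ.[𝕜] F} {C : G →ₗ.[𝕜] G}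
variable {ι_E ι_F ι_G : Type*} {b_E : HilbertBasis ι_E 𝕜 E} {b_F : HilbertBasis ι_F 𝕜 F} {b_G : HilbertBasis ι_G 𝕜 G}
  {μ_E : ι_E → ℝ} {μ_F : ι_F → ℝ} {μ_G : ι_G → ℝ}

omit [NormedAddCommGroup E'] [InnerProductSpace 𝕜 E'] [NormedAddCommGroup F'] [InnerProductSpace 𝕜 F']
  [NormedAddCommGroup G'] [InnerProductSpace 𝕜 G'] in
/-- **The non-zero spectrum of `□` below `λ` is that of `T*T` plus that of `SS*`, with multiplicity:
`#{j : 0 < μ_F j < λ} = #{i : 0 < μ_E i < λ} + #{k : 0 < μ_G k < λ}`** — Gilkey's `∑ (−1)ⁱ dim E_i(m) = 0` (`m ≠ 0`) summed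
over the finitely many spectral values `m ∈ (0, λ)`. [cite: Gilkey1995, §1.6 Lemma 1.6.5 (proof); McKeanSinger1967, §6 (3b);
BruningLesch1992, §2 Lemma 2.17 (proof, (2.50): the comparison map respects the weak Hodge decomposition)] -/
theorem ncard_eigenvalue_pos_lt_eq_add_of_short_complex (hdT : Dense (T.domain : Set E))
    (hdS : Dense (S.domain : Set F))
    (hST : LinearMap.range T.toFun ≤ (LinearMap.ker S.toFun).map S.domain.subtype)
    (hdomA : ∀ x : E, x ∈ A.domain ↔ ∃ hx : x ∈ T.domain, T ⟨x, hx⟩ ∈ T†.domain)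
    (hvalA : ∀ (x : A.domain) (hx : (x : E) ∈ T.domain) (hTx : T ⟨x, hx⟩ ∈ T†.domain),
      A x = T† ⟨T ⟨x, hx⟩, hTx⟩)
    (hdom : ∀ x : F, x ∈ L.domain ↔ (∃ hxT : x ∈ T†.domain, T† ⟨x, hxT⟩ ∈ T.domain) ∧
      (∃ hxS : x ∈ S.domain, S ⟨x, hxS⟩ ∈ S†.domain))
    (hval : ∀ (x : L.domain) (hxT : (x : F) ∈ T†.domain) (hTx : T† ⟨x, hxT⟩ ∈ T.domain)
      (hxS : (x : F) ∈ S.domain) (hSx : S ⟨x, hxS⟩ ∈ S†.domain),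
      L x = T ⟨T† ⟨x, hxT⟩, hTx⟩ + S† ⟨S ⟨x, hxS⟩, hSx⟩)
    (hdomC : ∀ y : G, y ∈ C.domain ↔ ∃ hy : y ∈ S†.domain, S† ⟨y, hy⟩ ∈ S.domain)
    (hvalC : ∀ (y : C.domain) (hy : (y : G) ∈ S†.domain) (hSy : S† ⟨y, hy⟩ ∈ S.domain),
      C y = S ⟨S† ⟨y, hy⟩, hSy⟩)
    (heig_E : ∀ i, ∃ h : (b_E i : E) ∈ A.domain, A ⟨b_E i, h⟩ = ((μ_E i : ℝ) : 𝕜) • (b_E i : E))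
    (heig_F : ∀ j, ∃ h : (b_F j : F) ∈ L.domain, L ⟨b_F j, h⟩ = ((μ_F j : ℝ) : 𝕜) • (b_F j : F))
    (heig_G : ∀ k, ∃ h : (b_G k : G) ∈ C.domain, C ⟨b_G k, h⟩ = ((μ_G k : ℝ) : 𝕜) • (b_G k : G))
    (htend_E : Tendsto μ_E cofinite atTop) (htend_F : Tendsto μ_F cofinite atTop)
    (htend_G : Tendsto μ_G cofinite atTop) (l : ℝ) :
    {j | 0 < μ_F j ∧ μ_F j < l}.ncard = {i | 0 < μ_E i ∧ μ_E i < l}.ncard + {k | 0 < μ_G k ∧ μ_G k < l}.ncard := by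
  classical
  have hs_E : {i | 0 < μ_E i ∧ μ_E i < l}.Finite := (finite_setOf_eigenvalue_le htend_E l).subset fun i hi ↦ hi.2.le
  have hs_F : {j | 0 < μ_F j ∧ μ_F j < l}.Finite := (finite_setOf_eigenvalue_le htend_F l).subset fun i hi ↦ hi.2.le
  have hs_G : {k | 0 < μ_G k ∧ μ_G k < l}.Finite := (finite_setOf_eigenvalue_le htend_G l).subset fun i hi ↦ hi.2.le
  -- the finite set of spectral values in `(0, λ)` of the three Laplacians
  set M : Finset ℝ := hs_E.toFinset.image μ_E ∪ hs_F.toFinset.image μ_F ∪ hs_G.toFinset.image μ_G with hM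
  have hM' : ∀ m ∈ M, 0 < m ∧ m < l := fun m hm ↦ by
    simp only [hM, Finset.mem_union, Finset.mem_image, Set.Finite.mem_toFinset, Set.mem_setOf_eq] at hm
    rcases hm with (⟨i, hi, rfl⟩ | ⟨i, hi, rfl⟩) | ⟨i, hi, rfl⟩ <;> exact hi
  have hM_E : ∀ i, 0 < μ_E i → μ_E i < l → μ_E i ∈ M := fun i h1 h2 ↦ by
    simp only [hM, Finset.mem_union, Finset.mem_image, Set.Finite.mem_toFinset, Set.mem_setOf_eq]
    exact Or.inl (Or.inl ⟨i, ⟨h1, h2⟩, rfl⟩)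
  have hM_F : ∀ j, 0 < μ_F j → μ_F j < l → μ_F j ∈ M := fun j h1 h2 ↦ by
    simp only [hM, Finset.mem_union, Finset.mem_image, Set.Finite.mem_toFinset, Set.mem_setOf_eq]
    exact Or.inl (Or.inr ⟨j, ⟨h1, h2⟩, rfl⟩)
  have hM_G : ∀ k, 0 < μ_G k → μ_G k < l → μ_G k ∈ M := fun k h1 h2 ↦ by
    simp only [hM, Finset.mem_union, Finset.mem_image, Set.Finite.mem_toFinset, Set.mem_setOf_eq]
    exact Or.inr ⟨k, ⟨h1, h2⟩, rfl⟩
  rw [ncard_pos_lt_eq_sum hs_F M hM_F hM', ncard_pos_lt_eq_sum hs_E M hM_E hM', ncard_pos_lt_eq_sum hs_G M hM_G hM',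
    ← Finset.sum_add_distrib]
  exact Finset.sum_congr rfl fun m hm ↦ ncard_eigenvalue_eq_add_of_short_complex hdT hdS hST hdomA hvalA hdom hval
    hdomC hvalC heig_E heig_F heig_G (hM' m hm).1.ne' (finite_setOf_eigenvalue_eq htend_E m)
    (finite_setOf_eigenvalue_eq htend_F m) (finite_setOf_eigenvalue_eq htend_G m)

omit [NormedAddCommGroup E'] [InnerProductSpace 𝕜 E'] [NormedAddCommGroup F'] [InnerProductSpace 𝕜 F']
  [NormedAddCommGroup G'] [InnerProductSpace 𝕜 G'] in
/-- **`N_□(λ) + z_E + z_G = z_F + N_{T*T}(λ) + N_{SS*}(λ)` for `λ > 0`** (`N_X(λ) = #{μ_X < λ}`, `z_X = #{μ_X = 0}`; each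
`N_X(λ) = z_X + #{0 < μ_X < λ}` since the Laplacians are non-negative, and the previous theorem). [cite: Gilkey1995, §1.6
Lemma 1.6.5; BruningLesch1992, §2 Lemma 2.17 (proof)] -/
theorem ncard_eigenvalue_lt_add_eq_of_short_complex (hdT : Dense (T.domain : Set E))
    (hdS : Dense (S.domain : Set F))
    (hST : LinearMap.range T.toFun ≤ (LinearMap.ker S.toFun).map S.domain.subtype)
    (hdomA : ∀ x : E, x ∈ A.domain ↔ ∃ hx : x ∈ T.domain, T ⟨x, hx⟩ ∈ T†.domain)
    (hvalA : ∀ (x : A.domain) (hx : (x : E) ∈ T.domain) (hTx : T ⟨x, hx⟩ ∈ T†.domain),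
      A x = T† ⟨T ⟨x, hx⟩, hTx⟩)
    (hdom : ∀ x : F, x ∈ L.domain ↔ (∃ hxT : x ∈ T†.domain, T† ⟨x, hxT⟩ ∈ T.domain) ∧
      (∃ hxS : x ∈ S.domain, S ⟨x, hxS⟩ ∈ S†.domain))
    (hval : ∀ (x : L.domain) (hxT : (x : F) ∈ T†.domain) (hTx : T† ⟨x, hxT⟩ ∈ T.domain)
      (hxS : (x : F) ∈ S.domain) (hSx : S ⟨x, hxS⟩ ∈ S†.domain),
      L x = T ⟨T† ⟨x, hxT⟩, hTx⟩ + S† ⟨S ⟨x, hxS⟩, hSx⟩)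
    (hdomC : ∀ y : G, y ∈ C.domain ↔ ∃ hy : y ∈ S†.domain, S† ⟨y, hy⟩ ∈ S.domain)
    (hvalC : ∀ (y : C.domain) (hy : (y : G) ∈ S†.domain) (hSy : S† ⟨y, hy⟩ ∈ S.domain),
      C y = S ⟨S† ⟨y, hy⟩, hSy⟩)
    (heig_E : ∀ i, ∃ h : (b_E i : E) ∈ A.domain, A ⟨b_E i, h⟩ = ((μ_E i : ℝ) : 𝕜) • (b_E i : E))
    (heig_F : ∀ j, ∃ h : (b_F j : F) ∈ L.domain, L ⟨b_F j, h⟩ = ((μ_F j : ℝ) : 𝕜) • (b_F j : F))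
    (heig_G : ∀ k, ∃ h : (b_G k : G) ∈ C.domain, C ⟨b_G k, h⟩ = ((μ_G k : ℝ) : 𝕜) • (b_G k : G))
    (htend_E : Tendsto μ_E cofinite atTop) (htend_F : Tendsto μ_F cofinite atTop)
    (htend_G : Tendsto μ_G cofinite atTop) {l : ℝ} (hl : 0 < l) :
    {j | μ_F j < l}.ncard + {i | μ_E i = 0}.ncard + {k | μ_G k = 0}.ncard =
      {j | μ_F j = 0}.ncard + {i | μ_E i < l}.ncard + {k | μ_G k < l}.ncard := by
  have hμE : ∀ i, 0 ≤ μ_E i := fun i ↦ eigenvalue_nonneg dense_zero_pmap_domain hdT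
    (laplacian_domain_iff_of_adjointCompSelf hdomA) (laplacian_apply_of_adjointCompSelf hvalA)
    (b_E.orthonormal.ne_zero i) (heig_E i)
  have hμF : ∀ j, 0 ≤ μ_F j := fun j ↦ eigenvalue_nonneg hdT hdS hdom hval (b_F.orthonormal.ne_zero j) (heig_F j)
  have hμG : ∀ k, 0 ≤ μ_G k := fun k ↦ eigenvalue_nonneg hdS dense_zero_pmap_domain
    (laplacian_domain_iff_of_selfCompAdjoint hdomC) (laplacian_apply_of_selfCompAdjoint hvalC)
    (b_G.orthonormal.ne_zero k) (heig_G k)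
  rw [ncard_lt_eq_ncard_zero_add hμE ((finrank_span_eigenvectors_lt b_E htend_E l).1) hl,
    ncard_lt_eq_ncard_zero_add hμF ((finrank_span_eigenvectors_lt b_F htend_F l).1) hl,
    ncard_lt_eq_ncard_zero_add hμG ((finrank_span_eigenvectors_lt b_G htend_G l).1) hl,
    ncard_eigenvalue_pos_lt_eq_add_of_short_complex hdT hdS hST hdomA hvalA hdom hval hdomC hvalC heig_E heig_F heig_G
      htend_E htend_F htend_G l]
  ring

end OneComplex

/-! ### §2 The kernel multiplicities `z_E = dim Ker T`, `z_F = dim 𝔥`, `z_G = dim Ker S*` are isomorphism invariants -/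

section KernelCounts

variable {T : E →ₗ.[𝕜] F} {S : F →ₗ.[𝕜] G} {A : E →ₗ.[𝕜] E} {L : F →ₗ.[𝕜] F} {C : G →ₗ.[𝕜] G}
variable {ι_E ι_F ι_G : Type*} {b_E : HilbertBasis ι_E 𝕜 E} {b_F : HilbertBasis ι_F 𝕜 F} {b_G : HilbertBasis ι_G 𝕜 G}
  {μ_E : ι_E → ℝ} {μ_F : ι_F → ℝ} {μ_G : ι_G → ℝ}
variable {T' : E' →ₗ.[𝕜] F'} {S' : F' →ₗ.[𝕜] G'} {A' : E' →ₗ.[𝕜] E'} {L' : F' →ₗ.[𝕜] F'} {C' : G' →ₗ.[𝕜] G'}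
variable {ι'_E ι'_F ι'_G : Type*} {b'_E : HilbertBasis ι'_E 𝕜 E'} {b'_F : HilbertBasis ι'_F 𝕜 F'}
  {b'_G : HilbertBasis ι'_G 𝕜 G'} {μ'_E : ι'_E → ℝ} {μ'_F : ι'_F → ℝ} {μ'_G : ι'_G → ℝ}
variable {g_E : E →L[𝕜] E'} {g_F : F →L[𝕜] F'} {g_G : G →L[𝕜] G'}
  {k_E : E' →L[𝕜] E} {k_F : F' →L[𝕜] F} {k_G : G' →L[𝕜] G}

omit [NormedAddCommGroup G] [InnerProductSpace 𝕜 G] [NormedAddCommGroup G'] [InnerProductSpace 𝕜 G'] in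
/-- **`z_E = #{i : μ_E i = 0} = dim Ker T` is an isomorphism invariant** (`Ker T ≅ Ker T′`, Cor 2.19 degree `0`).
[cite: BruningLesch1992, §2 Cor 2.19, Lemma 2.17; Gilkey1995, §1.6 Lemma 1.6.5 (`dim E_i(0)`)] -/
theorem ncard_eigenvalue_zero_adjointCompSelf_eq_of_iso [CompleteSpace E] [CompleteSpace E']
    (hdT : Dense (T.domain : Set E))
    (hdomA : ∀ x : E, x ∈ A.domain ↔ ∃ hx : x ∈ T.domain, T ⟨x, hx⟩ ∈ T†.domain)
    (hvalA : ∀ (x : A.domain) (hx : (x : E) ∈ T.domain) (hTx : T ⟨x, hx⟩ ∈ T†.domain),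
      A x = T† ⟨T ⟨x, hx⟩, hTx⟩)
    (heig_E : ∀ i, ∃ h : (b_E i : E) ∈ A.domain, A ⟨b_E i, h⟩ = ((μ_E i : ℝ) : 𝕜) • (b_E i : E))
    (htend_E : Tendsto μ_E cofinite atTop)
    (hdT' : Dense (T'.domain : Set E'))
    (hdomA' : ∀ x : E', x ∈ A'.domain ↔ ∃ hx : x ∈ T'.domain, T' ⟨x, hx⟩ ∈ T'†.domain)
    (hvalA' : ∀ (x : A'.domain) (hx : (x : E') ∈ T'.domain) (hTx : T' ⟨x, hx⟩ ∈ T'†.domain),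
      A' x = T'† ⟨T' ⟨x, hx⟩, hTx⟩)
    (heig'_E : ∀ i, ∃ h : (b'_E i : E') ∈ A'.domain, A' ⟨b'_E i, h⟩ = ((μ'_E i : ℝ) : 𝕜) • (b'_E i : E'))
    (htend'_E : Tendsto μ'_E cofinite atTop)
    (hgT : ∀ (w : E) (hw : w ∈ T.domain), ∃ h : g_E w ∈ T'.domain, T' ⟨g_E w, h⟩ = g_F (T ⟨w, hw⟩))
    (hkT : ∀ (w' : E') (hw' : w' ∈ T'.domain), ∃ h : k_E w' ∈ T.domain, T ⟨k_E w', h⟩ = k_F (T' ⟨w', hw'⟩))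
    (hkg_E : ∀ w : E, k_E (g_E w) = w) (hgk_E : ∀ w' : E', g_E (k_E w') = w') :
    {i | μ_E i = 0}.ncard = {i | μ'_E i = 0}.ncard := by
  rw [ncard_eigenvalue_zero_eq_finrank_pmapKer hdT hdomA hvalA heig_E htend_E,
    ncard_eigenvalue_zero_eq_finrank_pmapKer hdT' hdomA' hvalA' heig'_E htend'_E]
  exact finrank_pmapKer_eq_of_iso hgT hkT hkg_E hgk_E

/-- **`z_F = #{j : μ_F j = 0} = dim 𝔥` is an isomorphism invariant** ("the dimension of `𝓗̂_i` is invariant under complex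
isomorphisms"). [cite: BruningLesch1992, §2 Lemma 2.7, Cor 2.19, Lemma 2.17; Gilkey1995, §1.6 Lemma 1.6.5] -/
theorem ncard_eigenvalue_zero_laplacian_eq_of_iso [CompleteSpace E] [CompleteSpace F] [CompleteSpace E']
    [CompleteSpace F'] (hdT : Dense (T.domain : Set E)) (hdS : Dense (S.domain : Set F)) (hcS : S.IsClosed)
    (hST : LinearMap.range T.toFun ≤ (LinearMap.ker S.toFun).map S.domain.subtype)
    (hdom : ∀ x : F, x ∈ L.domain ↔ (∃ hxT : x ∈ T†.domain, T† ⟨x, hxT⟩ ∈ T.domain) ∧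
      (∃ hxS : x ∈ S.domain, S ⟨x, hxS⟩ ∈ S†.domain))
    (hval : ∀ (x : L.domain) (hxT : (x : F) ∈ T†.domain) (hTx : T† ⟨x, hxT⟩ ∈ T.domain)
      (hxS : (x : F) ∈ S.domain) (hSx : S ⟨x, hxS⟩ ∈ S†.domain),
      L x = T ⟨T† ⟨x, hxT⟩, hTx⟩ + S† ⟨S ⟨x, hxS⟩, hSx⟩)
    (heig_F : ∀ j, ∃ h : (b_F j : F) ∈ L.domain, L ⟨b_F j, h⟩ = ((μ_F j : ℝ) : 𝕜) • (b_F j : F))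
    (htend_F : Tendsto μ_F cofinite atTop)
    (hdT' : Dense (T'.domain : Set E')) (hdS' : Dense (S'.domain : Set F')) (hcS' : S'.IsClosed)
    (hST' : LinearMap.range T'.toFun ≤ (LinearMap.ker S'.toFun).map S'.domain.subtype)
    (hdom' : ∀ x : F', x ∈ L'.domain ↔ (∃ hxT : x ∈ T'†.domain, T'† ⟨x, hxT⟩ ∈ T'.domain) ∧
      (∃ hxS : x ∈ S'.domain, S' ⟨x, hxS⟩ ∈ S'†.domain))
    (hval' : ∀ (x : L'.domain) (hxT : (x : F') ∈ T'†.domain) (hTx : T'† ⟨x, hxT⟩ ∈ T'.domain)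
      (hxS : (x : F') ∈ S'.domain) (hSx : S' ⟨x, hxS⟩ ∈ S'†.domain),
      L' x = T' ⟨T'† ⟨x, hxT⟩, hTx⟩ + S'† ⟨S' ⟨x, hxS⟩, hSx⟩)
    (heig'_F : ∀ j, ∃ h : (b'_F j : F') ∈ L'.domain, L' ⟨b'_F j, h⟩ = ((μ'_F j : ℝ) : 𝕜) • (b'_F j : F'))
    (htend'_F : Tendsto μ'_F cofinite atTop)
    (hgT : ∀ (w : E) (hw : w ∈ T.domain), ∃ h : g_E w ∈ T'.domain, T' ⟨g_E w, h⟩ = g_F (T ⟨w, hw⟩))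
    (hgS : ∀ (u : F) (hu : u ∈ S.domain), ∃ h : g_F u ∈ S'.domain, S' ⟨g_F u, h⟩ = g_G (S ⟨u, hu⟩))
    (hkT : ∀ (w' : E') (hw' : w' ∈ T'.domain), ∃ h : k_E w' ∈ T.domain, T ⟨k_E w', h⟩ = k_F (T' ⟨w', hw'⟩))
    (hkS : ∀ (u' : F') (hu' : u' ∈ S'.domain), ∃ h : k_F u' ∈ S.domain, S ⟨k_F u', h⟩ = k_G (S' ⟨u', hu'⟩))
    (hkg_F : ∀ u : F, k_F (g_F u) = u) (hgk_F : ∀ u' : F', g_F (k_F u') = u') :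
    {j | μ_F j = 0}.ncard = {j | μ'_F j = 0}.ncard := by
  rw [← finrank_harmonic_eq_ncard hdT hdS hdom hval heig_F htend_F,
    ← finrank_harmonic_eq_ncard hdT' hdS' hdom' hval' heig'_F htend'_F]
  exact finrank_harmonic_eq_of_iso hdT hcS hST hdT' hcS' hST' hgT hgS hkT hkS hkg_F hgk_F

omit [NormedAddCommGroup E] [InnerProductSpace 𝕜 E] [NormedAddCommGroup E'] [InnerProductSpace 𝕜 E'] in
/-- **`z_G = #{k : μ_G k = 0} = dim Ker S*` is an isomorphism invariant**: the adjoints `k_G*, k_F*` and `g_G*, g_F*`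
are mutually inverse maps between the dual complexes (row g34-#7 §1, "`h := (g⁻¹)*` is also a complex isomorphism"), so
`Ker S* ≅ Ker S′*`. [cite: BruningLesch1992, §2 p. 103, Cor 2.6, Cor 2.19, Lemma 2.17; Gilkey1995, §1.6 Lemma 1.6.5] -/
theorem ncard_eigenvalue_zero_selfCompAdjoint_eq_of_iso [CompleteSpace F] [CompleteSpace G] [CompleteSpace F']
    [CompleteSpace G'] (hdS : Dense (S.domain : Set F))
    (hdomC : ∀ y : G, y ∈ C.domain ↔ ∃ hy : y ∈ S†.domain, S† ⟨y, hy⟩ ∈ S.domain)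
    (hvalC : ∀ (y : C.domain) (hy : (y : G) ∈ S†.domain) (hSy : S† ⟨y, hy⟩ ∈ S.domain),
      C y = S ⟨S† ⟨y, hy⟩, hSy⟩)
    (heig_G : ∀ k, ∃ h : (b_G k : G) ∈ C.domain, C ⟨b_G k, h⟩ = ((μ_G k : ℝ) : 𝕜) • (b_G k : G))
    (htend_G : Tendsto μ_G cofinite atTop)
    (hdS' : Dense (S'.domain : Set F'))
    (hdomC' : ∀ y : G', y ∈ C'.domain ↔ ∃ hy : y ∈ S'†.domain, S'† ⟨y, hy⟩ ∈ S'.domain)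
    (hvalC' : ∀ (y : C'.domain) (hy : (y : G') ∈ S'†.domain) (hSy : S'† ⟨y, hy⟩ ∈ S'.domain),
      C' y = S' ⟨S'† ⟨y, hy⟩, hSy⟩)
    (heig'_G : ∀ k, ∃ h : (b'_G k : G') ∈ C'.domain, C' ⟨b'_G k, h⟩ = ((μ'_G k : ℝ) : 𝕜) • (b'_G k : G'))
    (htend'_G : Tendsto μ'_G cofinite atTop)
    (hgS : ∀ (u : F) (hu : u ∈ S.domain), ∃ h : g_F u ∈ S'.domain, S' ⟨g_F u, h⟩ = g_G (S ⟨u, hu⟩))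
    (hkS : ∀ (u' : F') (hu' : u' ∈ S'.domain), ∃ h : k_F u' ∈ S.domain, S ⟨k_F u', h⟩ = k_G (S' ⟨u', hu'⟩))
    (hkg_G : ∀ z : G, k_G (g_G z) = z) (hgk_G : ∀ z' : G', g_G (k_G z') = z') :
    {k | μ_G k = 0}.ncard = {k | μ'_G k = 0}.ncard := by
  rw [ncard_eigenvalue_zero_eq_finrank_pmapKer_adjoint hdS hdomC hvalC heig_G htend_G,
    ncard_eigenvalue_zero_eq_finrank_pmapKer_adjoint hdS' hdomC' hvalC' heig'_G htend'_G]
  obtain ⟨e⟩ := nonempty_pmapKer_linearEquiv_of_iso (T := S†) (T' := S'†)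
    (g_E := ContinuousLinearMap.adjoint k_G) (g_F := ContinuousLinearMap.adjoint k_F)
    (k_E := ContinuousLinearMap.adjoint g_G) (k_F := ContinuousLinearMap.adjoint g_F)
    (adjoint_map_of_map (T := S) (T' := S') hdS hdS' hkS) (adjoint_map_of_map (T := S') (T' := S) hdS' hdS hgS)
    (adjoint_apply_adjoint_apply_of_leftInverse hkg_G) (adjoint_apply_adjoint_apply_of_leftInverse hgk_G)
  exact e.finrank_eq

end KernelCounts

/-! ### §3 Lemma 2.17 (2.52) for the middle Laplacian `□` -/

section Middle

variable [CompleteSpace E] [CompleteSpace F] [CompleteSpace G] [CompleteSpace E'] [CompleteSpace F']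
  [CompleteSpace G']
variable {T : E →ₗ.[𝕜] F} {S : F →ₗ.[𝕜] G} {A : E →ₗ.[𝕜] E} {L : F →ₗ.[𝕜] F} {C : G →ₗ.[𝕜] G}
variable {ι_E ι_F ι_G : Type*} {b_E : HilbertBasis ι_E 𝕜 E} {b_F : HilbertBasis ι_F 𝕜 F} {b_G : HilbertBasis ι_G 𝕜 G}
  {μ_E : ι_E → ℝ} {μ_F : ι_F → ℝ} {μ_G : ι_G → ℝ}
variable {T' : E' →ₗ.[𝕜] F'} {S' : F' →ₗ.[𝕜] G'} {A' : E' →ₗ.[𝕜] E'} {L' : F' →ₗ.[𝕜] F'} {C' : G' →ₗ.[𝕜] G'}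
variable {ι'_E ι'_F ι'_G : Type*} {b'_E : HilbertBasis ι'_E 𝕜 E'} {b'_F : HilbertBasis ι'_F 𝕜 F'}
  {b'_G : HilbertBasis ι'_G 𝕜 G'} {μ'_E : ι'_E → ℝ} {μ'_F : ι'_F → ℝ} {μ'_G : ι'_G → ℝ}
variable {g_E : E →L[𝕜] E'} {g_F : F →L[𝕜] F'} {g_G : G →L[𝕜] G'}
  {k_E : E' →L[𝕜] E} {k_F : F' →L[𝕜] F} {k_G : G' →L[𝕜] G}

/-- **Lemma 2.17 (2.52), middle degree**: for an isomorphism `(g_E, g_F, g_G) ⇄ (k_E, k_F, k_G)` of discrete short complexes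
(all three Laplacians on each side with eigenbases) with `‖g_F‖, ‖g_G‖ ≤ M_g` and `‖k_E‖, ‖k_F‖ ≤ M_k`,
`#{j : μ_F j < λ} ≤ #{j : μ′_F j < (M_g M_k)²λ}` for every `λ` (`λ′ₙ(□′) ≤ Cλₙ(□)`, `C = (M_g M_k)²`). Proof:
`N_□(λ) = z_F + n_{T*T}(λ) + n_{SS*}(λ)` (§1), `z_E, z_F, z_G` are invariants (§2), and `n_{T*T}(λ) ≤ n_{T′*T′}(Cλ)`,
`n_{SS*}(λ) ≤ n_{S′S′*}(Cλ)` by row g34-#7. [cite: BruningLesch1992, §2 Lemma 2.17 (2.52) (proof via (2.50)–(2.51));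
Gilkey1995, §1.6 Lemma 1.6.5; Schmudgen2012, §12.1 Thm 12.1] -/
theorem ncard_eigenvalue_laplacian_lt_le_of_iso (hdT : Dense (T.domain : Set E)) (hdS : Dense (S.domain : Set F))
    (hcS : S.IsClosed) (hST : LinearMap.range T.toFun ≤ (LinearMap.ker S.toFun).map S.domain.subtype)
    (hdomA : ∀ x : E, x ∈ A.domain ↔ ∃ hx : x ∈ T.domain, T ⟨x, hx⟩ ∈ T†.domain)
    (hvalA : ∀ (x : A.domain) (hx : (x : E) ∈ T.domain) (hTx : T ⟨x, hx⟩ ∈ T†.domain),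
      A x = T† ⟨T ⟨x, hx⟩, hTx⟩)
    (hdom : ∀ x : F, x ∈ L.domain ↔ (∃ hxT : x ∈ T†.domain, T† ⟨x, hxT⟩ ∈ T.domain) ∧
      (∃ hxS : x ∈ S.domain, S ⟨x, hxS⟩ ∈ S†.domain))
    (hval : ∀ (x : L.domain) (hxT : (x : F) ∈ T†.domain) (hTx : T† ⟨x, hxT⟩ ∈ T.domain)
      (hxS : (x : F) ∈ S.domain) (hSx : S ⟨x, hxS⟩ ∈ S†.domain),
      L x = T ⟨T† ⟨x, hxT⟩, hTx⟩ + S† ⟨S ⟨x, hxS⟩, hSx⟩)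
    (hdomC : ∀ y : G, y ∈ C.domain ↔ ∃ hy : y ∈ S†.domain, S† ⟨y, hy⟩ ∈ S.domain)
    (hvalC : ∀ (y : C.domain) (hy : (y : G) ∈ S†.domain) (hSy : S† ⟨y, hy⟩ ∈ S.domain),
      C y = S ⟨S† ⟨y, hy⟩, hSy⟩)
    (heig_E : ∀ i, ∃ h : (b_E i : E) ∈ A.domain, A ⟨b_E i, h⟩ = ((μ_E i : ℝ) : 𝕜) • (b_E i : E))
    (heig_F : ∀ j, ∃ h : (b_F j : F) ∈ L.domain, L ⟨b_F j, h⟩ = ((μ_F j : ℝ) : 𝕜) • (b_F j : F))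
    (heig_G : ∀ k, ∃ h : (b_G k : G) ∈ C.domain, C ⟨b_G k, h⟩ = ((μ_G k : ℝ) : 𝕜) • (b_G k : G))
    (htend_E : Tendsto μ_E cofinite atTop) (htend_F : Tendsto μ_F cofinite atTop)
    (htend_G : Tendsto μ_G cofinite atTop)
    (hdT' : Dense (T'.domain : Set E')) (hdS' : Dense (S'.domain : Set F')) (hcS' : S'.IsClosed)
    (hST' : LinearMap.range T'.toFun ≤ (LinearMap.ker S'.toFun).map S'.domain.subtype)
    (hdomA' : ∀ x : E', x ∈ A'.domain ↔ ∃ hx : x ∈ T'.domain, T' ⟨x, hx⟩ ∈ T'†.domain)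
    (hvalA' : ∀ (x : A'.domain) (hx : (x : E') ∈ T'.domain) (hTx : T' ⟨x, hx⟩ ∈ T'†.domain),
      A' x = T'† ⟨T' ⟨x, hx⟩, hTx⟩)
    (hdom' : ∀ x : F', x ∈ L'.domain ↔ (∃ hxT : x ∈ T'†.domain, T'† ⟨x, hxT⟩ ∈ T'.domain) ∧
      (∃ hxS : x ∈ S'.domain, S' ⟨x, hxS⟩ ∈ S'†.domain))
    (hval' : ∀ (x : L'.domain) (hxT : (x : F') ∈ T'†.domain) (hTx : T'† ⟨x, hxT⟩ ∈ T'.domain)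
      (hxS : (x : F') ∈ S'.domain) (hSx : S' ⟨x, hxS⟩ ∈ S'†.domain),
      L' x = T' ⟨T'† ⟨x, hxT⟩, hTx⟩ + S'† ⟨S' ⟨x, hxS⟩, hSx⟩)
    (hdomC' : ∀ y : G', y ∈ C'.domain ↔ ∃ hy : y ∈ S'†.domain, S'† ⟨y, hy⟩ ∈ S'.domain)
    (hvalC' : ∀ (y : C'.domain) (hy : (y : G') ∈ S'†.domain) (hSy : S'† ⟨y, hy⟩ ∈ S'.domain),
      C' y = S' ⟨S'† ⟨y, hy⟩, hSy⟩)
    (heig'_E : ∀ i, ∃ h : (b'_E i : E') ∈ A'.domain, A' ⟨b'_E i, h⟩ = ((μ'_E i : ℝ) : 𝕜) • (b'_E i : E'))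
    (heig'_F : ∀ j, ∃ h : (b'_F j : F') ∈ L'.domain, L' ⟨b'_F j, h⟩ = ((μ'_F j : ℝ) : 𝕜) • (b'_F j : F'))
    (heig'_G : ∀ k, ∃ h : (b'_G k : G') ∈ C'.domain, C' ⟨b'_G k, h⟩ = ((μ'_G k : ℝ) : 𝕜) • (b'_G k : G'))
    (htend'_E : Tendsto μ'_E cofinite atTop) (htend'_F : Tendsto μ'_F cofinite atTop)
    (htend'_G : Tendsto μ'_G cofinite atTop)
    (hgT : ∀ (w : E) (hw : w ∈ T.domain), ∃ h : g_E w ∈ T'.domain, T' ⟨g_E w, h⟩ = g_F (T ⟨w, hw⟩))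
    (hgS : ∀ (u : F) (hu : u ∈ S.domain), ∃ h : g_F u ∈ S'.domain, S' ⟨g_F u, h⟩ = g_G (S ⟨u, hu⟩))
    (hkT : ∀ (w' : E') (hw' : w' ∈ T'.domain), ∃ h : k_E w' ∈ T.domain, T ⟨k_E w', h⟩ = k_F (T' ⟨w', hw'⟩))
    (hkS : ∀ (u' : F') (hu' : u' ∈ S'.domain), ∃ h : k_F u' ∈ S.domain, S ⟨k_F u', h⟩ = k_G (S' ⟨u', hu'⟩))
    (hkg_E : ∀ w : E, k_E (g_E w) = w) (hgk_E : ∀ w' : E', g_E (k_E w') = w')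
    (hkg_F : ∀ u : F, k_F (g_F u) = u) (hgk_F : ∀ u' : F', g_F (k_F u') = u')
    (hkg_G : ∀ z : G, k_G (g_G z) = z) (hgk_G : ∀ z' : G', g_G (k_G z') = z')
    {Mg Mk : ℝ} (hMg : 0 < Mg) (hMk : 0 < Mk) (hgF : ∀ y : F, ‖g_F y‖ ≤ Mg * ‖y‖)
    (hgG : ∀ z : G, ‖g_G z‖ ≤ Mg * ‖z‖) (hkE : ∀ w' : E', ‖k_E w'‖ ≤ Mk * ‖w'‖)
    (hkF : ∀ y' : F', ‖k_F y'‖ ≤ Mk * ‖y'‖) (l : ℝ) :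
    {j | μ_F j < l}.ncard ≤ {j | μ'_F j < (Mg * Mk) ^ 2 * l}.ncard := by
  rcases le_or_gt l 0 with hl | hl
  · -- no eigenvalue of the non-negative `□` lies below `λ ≤ 0`
    have hμF : ∀ j, 0 ≤ μ_F j := fun j ↦ eigenvalue_nonneg hdT hdS hdom hval (b_F.orthonormal.ne_zero j) (heig_F j)
    have h0 : {j | μ_F j < l} = ∅ := Set.eq_empty_iff_forall_notMem.2 fun j (hj : μ_F j < l) ↦
      (not_lt.2 ((hμF j).trans' hl)) hj
    rw [h0, Set.ncard_empty]
    exact Nat.zero_le _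
  · have hl' : 0 < (Mg * Mk) ^ 2 * l := mul_pos (pow_pos (mul_pos hMg hMk) 2) hl
    -- the two count identities
    have h1 := ncard_eigenvalue_lt_add_eq_of_short_complex hdT hdS hST hdomA hvalA hdom hval hdomC hvalC heig_E heig_F
      heig_G htend_E htend_F htend_G hl
    have h2 := ncard_eigenvalue_lt_add_eq_of_short_complex hdT' hdS' hST' hdomA' hvalA' hdom' hval' hdomC' hvalC'
      heig'_E heig'_F heig'_G htend'_E htend'_F htend'_G hl'
    -- the three kernel invariances
    have hzE := ncard_eigenvalue_zero_adjointCompSelf_eq_of_iso hdT hdomA hvalA heig_E htend_E hdT' hdomA' hvalA'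
      heig'_E htend'_E hgT hkT hkg_E hgk_E
    have hzF := ncard_eigenvalue_zero_laplacian_eq_of_iso hdT hdS hcS hST hdom hval heig_F htend_F hdT' hdS' hcS' hST'
      hdom' hval' heig'_F htend'_F hgT hgS hkT hkS hkg_F hgk_F
    have hzG := ncard_eigenvalue_zero_selfCompAdjoint_eq_of_iso hdS hdomC hvalC heig_G htend_G hdS' hdomC' hvalC'
      heig'_G htend'_G hgS hkS hkg_G hgk_G
    -- the two outer comparisons
    have hE := ncard_eigenvalue_adjointCompSelf_lt_le_of_map hdT hdomA hvalA heig_E htend_E hdT' hdomA' hvalA' heig'_E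
      htend'_E hgT hMg hMk hgF (fun w ↦ by
        calc ‖w‖ = ‖k_E (g_E w)‖ := by rw [hkg_E]
          _ ≤ Mk * ‖g_E w‖ := hkE _) l
    have hG := ncard_eigenvalue_selfCompAdjoint_lt_le_of_map hdS hdomC hvalC heig_G htend_G hdS' hdomC' hvalC'
      heig'_G htend'_G hkS hkg_G hMg hMk hgG hkF l
    omega

/-- **Lemma 2.17 (2.52) for the middle Laplacian, both inequalities**: with `‖g‖ ≤ M_g`, `‖k‖ ≤ M_k` in all three
degrees, `#{μ_F < λ} ≤ #{μ′_F < Cλ}` and `#{μ′_F < λ} ≤ #{μ_F < Cλ}`, `C = (M_g M_k)²` ("`C⁻¹λₙ ≤ λ′ₙ ≤ Cλₙ`, `n ≥ 1`").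
[cite: BruningLesch1992, §2 Lemma 2.17 (2.52); Gilkey1995, §1.6 Lemma 1.6.5; Schmudgen2012, §12.1 Thm 12.1] -/
theorem ncard_eigenvalue_laplacian_comparison_of_iso (hdT : Dense (T.domain : Set E))
    (hdS : Dense (S.domain : Set F)) (hcS : S.IsClosed)
    (hST : LinearMap.range T.toFun ≤ (LinearMap.ker S.toFun).map S.domain.subtype)
    (hdomA : ∀ x : E, x ∈ A.domain ↔ ∃ hx : x ∈ T.domain, T ⟨x, hx⟩ ∈ T†.domain)
    (hvalA : ∀ (x : A.domain) (hx : (x : E) ∈ T.domain) (hTx : T ⟨x, hx⟩ ∈ T†.domain),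
      A x = T† ⟨T ⟨x, hx⟩, hTx⟩)
    (hdom : ∀ x : F, x ∈ L.domain ↔ (∃ hxT : x ∈ T†.domain, T† ⟨x, hxT⟩ ∈ T.domain) ∧
      (∃ hxS : x ∈ S.domain, S ⟨x, hxS⟩ ∈ S†.domain))
    (hval : ∀ (x : L.domain) (hxT : (x : F) ∈ T†.domain) (hTx : T† ⟨x, hxT⟩ ∈ T.domain)
      (hxS : (x : F) ∈ S.domain) (hSx : S ⟨x, hxS⟩ ∈ S†.domain),
      L x = T ⟨T† ⟨x, hxT⟩, hTx⟩ + S† ⟨S ⟨x, hxS⟩, hSx⟩)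
    (hdomC : ∀ y : G, y ∈ C.domain ↔ ∃ hy : y ∈ S†.domain, S† ⟨y, hy⟩ ∈ S.domain)
    (hvalC : ∀ (y : C.domain) (hy : (y : G) ∈ S†.domain) (hSy : S† ⟨y, hy⟩ ∈ S.domain),
      C y = S ⟨S† ⟨y, hy⟩, hSy⟩)
    (heig_E : ∀ i, ∃ h : (b_E i : E) ∈ A.domain, A ⟨b_E i, h⟩ = ((μ_E i : ℝ) : 𝕜) • (b_E i : E))
    (heig_F : ∀ j, ∃ h : (b_F j : F) ∈ L.domain, L ⟨b_F j, h⟩ = ((μ_F j : ℝ) : 𝕜) • (b_F j : F))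
    (heig_G : ∀ k, ∃ h : (b_G k : G) ∈ C.domain, C ⟨b_G k, h⟩ = ((μ_G k : ℝ) : 𝕜) • (b_G k : G))
    (htend_E : Tendsto μ_E cofinite atTop) (htend_F : Tendsto μ_F cofinite atTop)
    (htend_G : Tendsto μ_G cofinite atTop)
    (hdT' : Dense (T'.domain : Set E')) (hdS' : Dense (S'.domain : Set F')) (hcS' : S'.IsClosed)
    (hST' : LinearMap.range T'.toFun ≤ (LinearMap.ker S'.toFun).map S'.domain.subtype)
    (hdomA' : ∀ x : E', x ∈ A'.domain ↔ ∃ hx : x ∈ T'.domain, T' ⟨x, hx⟩ ∈ T'†.domain)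
    (hvalA' : ∀ (x : A'.domain) (hx : (x : E') ∈ T'.domain) (hTx : T' ⟨x, hx⟩ ∈ T'†.domain),
      A' x = T'† ⟨T' ⟨x, hx⟩, hTx⟩)
    (hdom' : ∀ x : F', x ∈ L'.domain ↔ (∃ hxT : x ∈ T'†.domain, T'† ⟨x, hxT⟩ ∈ T'.domain) ∧
      (∃ hxS : x ∈ S'.domain, S' ⟨x, hxS⟩ ∈ S'†.domain))
    (hval' : ∀ (x : L'.domain) (hxT : (x : F') ∈ T'†.domain) (hTx : T'† ⟨x, hxT⟩ ∈ T'.domain)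
      (hxS : (x : F') ∈ S'.domain) (hSx : S' ⟨x, hxS⟩ ∈ S'†.domain),
      L' x = T' ⟨T'† ⟨x, hxT⟩, hTx⟩ + S'† ⟨S' ⟨x, hxS⟩, hSx⟩)
    (hdomC' : ∀ y : G', y ∈ C'.domain ↔ ∃ hy : y ∈ S'†.domain, S'† ⟨y, hy⟩ ∈ S'.domain)
    (hvalC' : ∀ (y : C'.domain) (hy : (y : G') ∈ S'†.domain) (hSy : S'† ⟨y, hy⟩ ∈ S'.domain),
      C' y = S' ⟨S'† ⟨y, hy⟩, hSy⟩)
    (heig'_E : ∀ i, ∃ h : (b'_E i : E') ∈ A'.domain, A' ⟨b'_E i, h⟩ = ((μ'_E i : ℝ) : 𝕜) • (b'_E i : E'))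
    (heig'_F : ∀ j, ∃ h : (b'_F j : F') ∈ L'.domain, L' ⟨b'_F j, h⟩ = ((μ'_F j : ℝ) : 𝕜) • (b'_F j : F'))
    (heig'_G : ∀ k, ∃ h : (b'_G k : G') ∈ C'.domain, C' ⟨b'_G k, h⟩ = ((μ'_G k : ℝ) : 𝕜) • (b'_G k : G'))
    (htend'_E : Tendsto μ'_E cofinite atTop) (htend'_F : Tendsto μ'_F cofinite atTop)
    (htend'_G : Tendsto μ'_G cofinite atTop)
    (hgT : ∀ (w : E) (hw : w ∈ T.domain), ∃ h : g_E w ∈ T'.domain, T' ⟨g_E w, h⟩ = g_F (T ⟨w, hw⟩))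
    (hgS : ∀ (u : F) (hu : u ∈ S.domain), ∃ h : g_F u ∈ S'.domain, S' ⟨g_F u, h⟩ = g_G (S ⟨u, hu⟩))
    (hkT : ∀ (w' : E') (hw' : w' ∈ T'.domain), ∃ h : k_E w' ∈ T.domain, T ⟨k_E w', h⟩ = k_F (T' ⟨w', hw'⟩))
    (hkS : ∀ (u' : F') (hu' : u' ∈ S'.domain), ∃ h : k_F u' ∈ S.domain, S ⟨k_F u', h⟩ = k_G (S' ⟨u', hu'⟩))
    (hkg_E : ∀ w : E, k_E (g_E w) = w) (hgk_E : ∀ w' : E', g_E (k_E w') = w')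
    (hkg_F : ∀ u : F, k_F (g_F u) = u) (hgk_F : ∀ u' : F', g_F (k_F u') = u')
    (hkg_G : ∀ z : G, k_G (g_G z) = z) (hgk_G : ∀ z' : G', g_G (k_G z') = z')
    {Mg Mk : ℝ} (hMg : 0 < Mg) (hMk : 0 < Mk) (hgE : ∀ w : E, ‖g_E w‖ ≤ Mg * ‖w‖)
    (hgF : ∀ y : F, ‖g_F y‖ ≤ Mg * ‖y‖) (hgG : ∀ z : G, ‖g_G z‖ ≤ Mg * ‖z‖)
    (hkE : ∀ w' : E', ‖k_E w'‖ ≤ Mk * ‖w'‖) (hkF : ∀ y' : F', ‖k_F y'‖ ≤ Mk * ‖y'‖)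
    (hkG : ∀ z' : G', ‖k_G z'‖ ≤ Mk * ‖z'‖) (l : ℝ) :
    {j | μ_F j < l}.ncard ≤ {j | μ'_F j < (Mg * Mk) ^ 2 * l}.ncard ∧
      {j | μ'_F j < l}.ncard ≤ {j | μ_F j < (Mg * Mk) ^ 2 * l}.ncard := by
  refine ⟨ncard_eigenvalue_laplacian_lt_le_of_iso hdT hdS hcS hST hdomA hvalA hdom hval hdomC hvalC heig_E heig_F heig_G
    htend_E htend_F htend_G hdT' hdS' hcS' hST' hdomA' hvalA' hdom' hval' hdomC' hvalC' heig'_E heig'_F heig'_G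
    htend'_E htend'_F htend'_G hgT hgS hkT hkS hkg_E hgk_E hkg_F hgk_F hkg_G hgk_G hMg hMk hgF hgG hkE hkF l, ?_⟩
  rw [mul_comm Mg Mk]
  exact ncard_eigenvalue_laplacian_lt_le_of_iso hdT' hdS' hcS' hST' hdomA' hvalA' hdom' hval' hdomC' hvalC' heig'_E
    heig'_F heig'_G htend'_E htend'_F htend'_G hdT hdS hcS hST hdomA hvalA hdom hval hdomC hvalC heig_E heig_F heig_G
    htend_E htend_F htend_G hkT hkS hgT hgS hgk_E hkg_E hgk_F hkg_F hgk_G hkg_G hMk hMg hkF hkG hgE hgF l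

end Middle

end Literature.Analysis.InnerProduct
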